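import Summits.BirchSwinnertonDyer.BirchSwinnertonDyer.Theorems.ManinLocalTwoThreeVertexAssembly
import Summits.BirchSwinnertonDyer.BirchSwinnertonDyer.Theorems.ManinLocalTwoThreeOddShiftReduction
import HarnessLib

/-!
# E-es-36x at `p = 2` from the three named vertex inputs (E-es-41m, E-es-42, E-es-43)

Summit `BirchSwinnertonDyer`, route `ManinLocalTwoThree` (cell bsd-f2-manin), crux C2 `ManinOddAtFour` (stmt-BirchSwinnertonDyer-22967),
line `kato_shift_two` v6, stub 3 `stub_cThreeImageResidual`; MEMO-es §25.12 ASSEMBLY ORDER (6)–(12).  Sequel to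
`Theorems/ManinLocalTwoThreeVertexAssembly.lean` (p3: the vertex step assembled, `eq_zero_of_vertexInputs`):

* **`relativeIharaParOddExact_two_of_vertexBodies t n`** — the body of es's E-es-36x `RelativeIharaShiftVanishingParOddExact 2 t n`
  (HOME/es/Sketch-es-g12.lean; `NotTrivialEisensteinAt` / `IsParabolicFun` unfolded as -ty types them) from the bodies of E-es-41m
  `ShiftInvariantIsOldUpToDiamondMin 2 t`, E-es-42 `AtkinLehnerStep 2 t` (p1's `atkinLehnerStep_of_sigma2` modulo σ2) and E-es-43
  `DeltaCharacterExtension t` (FACT, Serre's amalgam): `oddShiftReduction` (E-es-38, p1) brings the `tⁿ`-shift (`n` odd) to a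
  `t`-shift, `L = L′t` with `t ∤ L′` (`t ∥ L`), and `eq_zero_of_vertexInputs` finishes.  This is the odd-`t` leaf consumed by
  `multiShiftClassGenerationTwo_of_parabolicVanishing_exact` (p605607) — so that leaf is now reduced to three NAMED inputs.

No new definitions; nothing about BSD or Manin's conjecture is proved here.

References: G. Shimura (1971) §8.3 [cite: Shimura1971, §8.3 (8.3.2)]; cell memo HOME/MEMO-es.md §25.10–§25.12; HOME/es/Sketch-es-g12.lean.
-/

set_option autoImplicit false
set_option linter.dupNamespace false

open scoped MatrixGroups

open CongruenceSubgroup Literature.NumberTheory.EllipticCurves.ModularForms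
  Literature.NumberTheory.EllipticCurves.ModularForms.HidaCohomology
  Summit.BirchSwinnertonDyer.BirchSwinnertonDyer.Theorems.ConjSpanGenAllLevels
  Summit.BirchSwinnertonDyer.Rank1Residual.ManinAdditive

namespace Summit.BirchSwinnertonDyer.BirchSwinnertonDyer.Theorems.ManinLocalTwoThree

noncomputable section

/-! ### §5  E-es-36x at `p = 2` from the three named inputs -/

section Leaf

/-- **E-es-36x `RelativeIharaShiftVanishingParOddExact 2 t n` from E-es-41m, E-es-42, E-es-43** (bodies verbatim from
HOME/es/Sketch-es-g12.lean with `NotTrivialEisensteinAt`, `IsParabolicFun`, `KillsCuspsZeroInfty`, `IsShiftConj` unfolded, at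
`p = 2`): for a prime `t`, a level `L` with `t ∣ L`, `t² ∤ L`, odd `n`, a field `K` of characteristic `2`, a parabolic generalised
`λ`-eigen homomorphism `u` on `Γ₀(L)` off `S ⊇ primes(2tL)` with hNT(`t`) which is `tⁿ`-shift-invariant vanishes.  Route:
`oddShiftReduction` (E-es-38, p1) brings `tⁿ` to `t`; `L = L′t` with `t ∤ L′`; then `eq_zero_of_vertexInputs`.  This is the
odd-`t` leaf consumed by `multiShiftClassGenerationTwo_of_parabolicVanishing_exact` (p605607), reduced to three named inputs.
[cite: Shimura1971, §8.3 (8.3.2)] -/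
theorem relativeIharaParOddExact_two_of_vertexBodies (t n : ℕ)
    (h41 : (2 : ℕ).Prime → t.Prime →
      ∀ (K : Type) [Field K] [CharP K 2] (L' : ℕ) [NeZero L'] [NeZero t], ¬ t ∣ L' →
      ∀ (u : cocycles 0 (L' * t) K),
        degeneracyPullback 0 (L' * t) (L' * t * t) t K dvd_rfl (u : Gamma0 (L' * t) → Fin 1 → K) =
          degeneracyPullback 0 (L' * t) (L' * t * t) 1 K (by simp) (u : Gamma0 (L' * t) → Fin 1 → K) →
        ∃ (u₀ : cocycles 0 L' K) (ψ : ZMod t → K),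
          (u : Gamma0 (L' * t) → Fin 1 → K) =
            degeneracyPullback 0 L' (L' * t) 1 K (by simp) (u₀ : Gamma0 L' → Fin 1 → K) + diamondFun (L' * t) t K ψ)
    (h42 : (2 : ℕ).Prime → t.Prime →
      ∀ (K : Type) [Field K] [CharP K 2] (L' : ℕ) [NeZero L'] [NeZero t], ¬ t ∣ L' →
      ∀ (S : Finset ℕ) (lam : ℕ → K) (u : cocycles 0 (L' * t) K),
        (∀ q : ℕ, q.Prime → q ∣ 2 * t * L' → q ∈ S) →
        IsHeckeGenEigenvector S lam u →
        (∀ M : ℕ, ∃ r : ℕ, r.Prime ∧ r ∉ S ∧ r ≡ 1 [MOD t ^ M] ∧ lam r ≠ (r : K) + 1) →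
        ((∀ γ : Gamma0 (L' * t), Matrix.SpecialLinearGroup.mapGL ℚ (γ : SL(2, ℤ)) • (OnePoint.infty : OnePoint ℚ) =
              OnePoint.infty → (u : Gamma0 (L' * t) → Fin 1 → K) γ = 0) ∧
          (∀ γ : Gamma0 (L' * t), Matrix.SpecialLinearGroup.mapGL ℚ (γ : SL(2, ℤ)) • ((0 : ℚ) : OnePoint ℚ) =
              ((0 : ℚ) : OnePoint ℚ) → (u : Gamma0 (L' * t) → Fin 1 → K) γ = 0)) →
        degeneracyPullback 0 (L' * t) (L' * t * t) t K dvd_rfl (u : Gamma0 (L' * t) → Fin 1 → K) =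
          degeneracyPullback 0 (L' * t) (L' * t * t) 1 K (by simp) (u : Gamma0 (L' * t) → Fin 1 → K) →
        ∀ h : Gamma0 L', (t : ℤ) ∣ (h : SL(2, ℤ)) 0 0 →
        ∀ γ β : Gamma0 (L' * t),
          (((h : SL(2, ℤ)) * (γ : SL(2, ℤ)) * (h : SL(2, ℤ))⁻¹) 0 0 = (β : SL(2, ℤ)) 0 0 ∧
            ((h : SL(2, ℤ)) * (γ : SL(2, ℤ)) * (h : SL(2, ℤ))⁻¹) 0 1 = (t : ℤ) * (β : SL(2, ℤ)) 0 1 ∧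
            (t : ℤ) * ((h : SL(2, ℤ)) * (γ : SL(2, ℤ)) * (h : SL(2, ℤ))⁻¹) 1 0 = (β : SL(2, ℤ)) 1 0 ∧
            ((h : SL(2, ℤ)) * (γ : SL(2, ℤ)) * (h : SL(2, ℤ))⁻¹) 1 1 = (β : SL(2, ℤ)) 1 1) →
          (u : Gamma0 (L' * t) → Fin 1 → K) β = (u : Gamma0 (L' * t) → Fin 1 → K) γ)
    (h43 : t.Prime →
      ∀ (K : Type) [Field K] (L' : ℕ) [NeZero L'] [NeZero t], ¬ t ∣ L' →
      ∀ u : cocycles 0 L' K,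
        degeneracyPullback 0 L' (L' * t) t K dvd_rfl (u : Gamma0 L' → Fin 1 → K) =
          degeneracyPullback 0 L' (L' * t) 1 K (by simp) (u : Gamma0 L' → Fin 1 → K) →
        ∃ Φ : SL(2, Away t) → K,
          (∀ g ∈ Delta t L', ∀ g' ∈ Delta t L', Φ (g * g') = Φ g + Φ g') ∧
          ∀ γ : Gamma0 L', Φ (iota t (γ : SL(2, ℤ))) = (u : Gamma0 L' → Fin 1 → K) γ 0) :
    (2 : ℕ).Prime → t.Prime → Odd n →
    ∀ (K : Type) [Field K] [CharP K 2] (L : ℕ) [NeZero L] [NeZero t] (S : Finset ℕ)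
      (lam : ℕ → K) (u : cocycles 0 L K),
      t ∣ L → ¬ t ^ 2 ∣ L →
      (∀ q : ℕ, q.Prime → q ∣ 2 * t * L → q ∈ S) →
      IsHeckeGenEigenvector S lam u →
      (∀ M : ℕ, ∃ r : ℕ, r.Prime ∧ r ∉ S ∧ r ≡ 1 [MOD t ^ M] ∧ lam r ≠ (r : K) + 1) →
      (∀ γ : Gamma0 L, ∀ c : OnePoint ℚ, Matrix.SpecialLinearGroup.mapGL ℚ (γ : SL(2, ℤ)) • c = c →
        (u : Gamma0 L → Fin 1 → K) γ = 0) →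
      degeneracyPullback 0 L (L * t ^ n) (t ^ n) K dvd_rfl (u : Gamma0 L → Fin 1 → K) =
        degeneracyPullback 0 L (L * t ^ n) 1 K (by simp) (u : Gamma0 L → Fin 1 → K) →
      u = 0 := by
  intro h2 ht hn K _ _ L _ _ S lam u htL htsq hS hgen hNT hpar hshift
  -- `tⁿ`-shift invariance ⟹ `t`-shift invariance (E-es-38)
  have hshift1 := oddShiftReduction 2 t n h2 ht hn K L S lam u hS hgen hNT hshift
  -- `L = L′ t`, `t ∤ L′`
  obtain ⟨L', rfl⟩ : ∃ L', L = L' * t := ⟨L / t, (Nat.div_mul_cancel htL).symm⟩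
  haveI : NeZero L' := ⟨fun h => NeZero.ne (L' * t) (by rw [h, zero_mul])⟩
  have hL' : ¬ t ∣ L' := fun h => htsq (by rw [pow_two]; exact Nat.mul_dvd_mul h dvd_rfl |>.trans (by rw [mul_comm]))
  refine eq_zero_of_vertexInputs ht hL' S lam u (fun q hq hqd => hS q hq (hqd.trans ⟨2 * t, by ring⟩))
    hgen ?_ (fun γ c hc => congrFun (hpar γ c hc) 0) ?_ ?_ (h43 ht K L' hL')
  · obtain ⟨r, hr, hrS, -, hne⟩ := hNT 0
    exact ⟨r, hr, hrS, hne⟩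
  · exact h41 h2 ht K L' hL' u hshift1
  · have hS' : ∀ q : ℕ, q.Prime → q ∣ 2 * t * L' → q ∈ S :=
      fun q hq hqd => hS q hq (hqd.trans (Dvd.intro t (by ring)))
    refine h42 h2 ht K L' hL' S lam u hS' hgen hNT ⟨fun γ hγ => hpar γ _ hγ, fun γ hγ => hpar γ _ hγ⟩ hshift1
end Leaf

end

end Summit.BirchSwinnertonDyer.BirchSwinnertonDyer.Theorems.ManinLocalTwoThree
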